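import Summits.BirchSwinnertonDyer.Rank1Residual.Additive.ChiBranchRatLowerDvdUnitRows
import Summits.BirchSwinnertonDyer.Rank1Residual.Additive.ChiBranchRatLowerDvdOddEnds
import Summits.BirchSwinnertonDyer.Rank1Residual.Additive.ChiBranchRatLowerDvdEnds
import HarnessLib

/-!
# Unit-row discharge on the REDUCIBLE rows (X3♯(G-ord)): Wuthrich's printed half ALONE gives the
# one-sided nodes `ChiBranchRatLowerDvd[Odd]At`, hence the rational branch main conjecture and — at
# `p = 3` and on `I₀*` for `p ≥ 5` — `BSD(E,p)` for `r_an = 0` UNIT rows with NO typed input and NO image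
# hypothesis (cell `b2b-bsdres`, team n1011, seat n1011-p06 gen 2, OWNERS row T-N10R, phase 4, X3 unit rows)

HONEST FRAMING (cell `b2b-bsdres`, run/shared/lean/b2b/bsd-rank1-residual/, verbatim in every
file): the goal of the cell is to DELETE the COMBINATION-SHAPED residual classes of the
Birch–Swinnerton-Dyer formula for ALL analytic-rank `≤ 1` elliptic curves over `ℚ` — "full BSD
formula for every rank `≤ 1` curve in class `C`" assembled STRICTLY from published theorems — so
that the rank-`≤ 1` remainder becomes exactly the CONSTRUCTION-SHAPED classes, which are TYPED
(missing-input `Prop`s), NOT attempted. This is not "finishing BSD". Team n1011 (X4 ∧ `p = 3` / the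
additive block, §I items N10 / N11): research routes; prove what is provable now; no claim beyond
the stated classes; X3♯(G-ord) stays CONSTRUCTION-SHAPED as a class; labels / census / located gap
UNCHANGED; nothing is booked. Theorems only (no definition, no named fact minted; the Literature
inputs are explicit binders: `hWu` = Wuthrich 2014 Thm. 16 in its half-eigenspace reading, Delbourgo
1998 / 2002, Pal 2012, GZK, modularity).

## What and why

X3 twin of `ChiBranchRatLowerDvdUnitRows.lean` §1 / `ChiBranchRatLowerDvdUnitRowsEven.lean` (same
seat; there: X4, Kato's half under the surjective tower). On the REDUCIBLE rows (`W[p]` reducible,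
`W` additive potentially good ordinary at `p`) the printed half is WUTHRICH's (Thm. 16, no image
hypothesis), INTEGRAL in the tree's reading: `g₁ ∈ char_Λ X(E/ℚ_∞)` with `ι g₁ = u·ϖ·L_br`, `u ∈ ℤ_pˣ`
(`exists_mem_charIdeal_map_eq_unit_mul_[minus]branch_of_wuthrichHalf`, this seat's Ends files). On a
UNIT row — `L(E,1) = q·Ω_E`, `q ≠ 0`, `ord_p q = 0` — the constant term of `ϖ L_br` is a `p`-adic unit
(`CensusX41.norm_coeff_zero_odd/even`: MTT §I.13–I.14 + Birch/Pal, `c_∞ ∈ {1,2}`), so `u⁻¹ g₁` is a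
unit of `Λ`, `char_Λ X = Λ`, and the node holds with `G = u⁻¹ g₁`, `m = n = 0`; the splits of the Ends
files then give the rational branch main conjectures `ChiBranchRatCharEq[Odd]At W p` as THEOREMS on the
reducible unit rows, with NO image hypothesis and NO certificate. Unlike X4 ∧ surj, on X3 rows
`p`-torsion is possible, so the LOWER half of `BSD(E,p)` has content on unit rows; §3 composes the
class ends already in the tree (p252109 / p253502 at `p = 3`; p251406 / p253887 on `I₀*`, `p ≥ 5`) into
`BSD(E,p)` statements whose EVERY hypothesis is a published theorem (binder) or a row datum:
X3♯(G-ord) at `3`, `r_an = 0`, non-CM, non-anomalous, unit row ⟹ `BSD(E,3)`. Nothing booked; no label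
change; the class stays CONSTRUCTION-SHAPED off the unit rows.

References: C. Wuthrich, J. London Math. Soc. 90 (2014) Thm. 16 (p. 397) [Wuthrich2014];
Mazur–Tate–Teitelbaum, Invent. Math. 84 (1986) §I.10, §I.13–I.14 [MazurTateTeitelbaum1986Invent];
A. Pal, Proc. AMS (2012) Thm. 3.2 [Pal2012]; D. Delbourgo, Compositio 113 (1998) Prop. 4 (p. 144)
[Delbourgo1998]; D. Delbourgo, Glasgow Math. J. 44 (2002) Thm. (A), (B) (p. 40) [Delbourgo2002];
C. Skinner, E. Urban, Invent. Math. 195 (2014) Thm. 3.6.4 (p. 43) [SkinnerUrban2014].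
-/

noncomputable section

open scoped Classical MatrixGroups ModularForm NumberField

open CongruenceSubgroup WeierstrassCurve NumberField Literature.NumberTheory.EllipticCurves
  Literature.NumberTheory.EllipticCurves.ModularForms
  Literature.NumberTheory.EllipticCurves.Rank1Residual
  Literature.NumberTheory.EllipticCurves.Rank1Residual.Typed
  Literature.NumberTheory.GaloisRepresentations
  IsDedekindDomain

namespace Summit.BirchSwinnertonDyer.Rank1Residual.Additive

/-! ### §1 Reducible rows, odd branch (`p ≡ 3 (mod 4)`): the node and the rational MC on the unit rows -/

section GordOdd

variable {W : WeierstrassCurve ℚ} [W.IsElliptic] [W.IsGloballyMinimal] {p : ℕ} [hp : Fact p.Prime]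

/-- **UNIT rows, REDUCIBLE `W[p]`, (G-ord) odd branch: Wuthrich's half ALONE gives the one-sided node
`ChiBranchRatLowerDvdOddAt W p`.** For `W` globally minimal, additive and potentially good at
`p ≡ 3 (mod 4)` (`0 ≤ ord_p j`), `W[p]` reducible, and `L(E,1) = q·Ω_E` with `q ≠ 0`, `ord_p q = 0`:
for every twist datum, Wuthrich's `g₁ ∈ char_Λ X(E/ℚ_∞)` with `ι g₁ = u·ϖ·L_p⁻(f♭, α, ω^{(p−1)/2}, T)`,
`u ∈ ℤ_pˣ`, has UNIT constant term (`‖(ϖ L_p⁻)(0)‖ = ‖c_∞(E)·q‖ = 1`, `CensusX41.norm_coeff_zero_odd`),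
so `(u⁻¹ g₁) = Λ ∋ g` for every `g`, with `ι(u⁻¹ g₁) = ϖ L_p⁻`. No image hypothesis.
[cite: Wuthrich2014, Thm. 16 (p. 397)] [cite: MazurTateTeitelbaum1986Invent, §I.13–I.14]
[cite: Pal2012, Thm. 3.2] -/
theorem chiBranchRatLowerDvdOddAt_of_wuthrichHalf_of_unitLValue
    (hWu : Wuthrich2014.thm16_halfEigenCharIdeal_dvd_cyclotomicPrime)
    (hmod : hasEntireLFunction_rat) (hj : 0 ≤ padicValRat p W.j) (hredW : Red W p) (hadd : Addv W p)
    {q : ℚ} (hq : W.entireLFunction 1 = (q : ℂ) * (W.realPeriodRat : ℂ)) (hq0 : q ≠ 0)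
    (hv : padicValRat p q = 0) :
    ChiBranchRatLowerDvdOddAt W p := by
  intro V _ _ κ γ N _ f hp3 hCW hV hκ hγ hcv hf D ϖ hϖ g _hg
  have hp2 : p ≠ 2 := by omega
  -- Wuthrich's element
  obtain ⟨-, g₁, -, u, hιg₁⟩ :=
    exists_mem_charIdeal_map_eq_unit_mul_minusBranch_of_wuthrichHalf W p hWu hj hredW V hp3 hCW
      (Or.inl hV) hκ hγ hcv hf D ϖ hϖ
  -- `G := u⁻¹ g₁`, `ι G = ϖ L⁻`
  have hCu : iwasawaToPowerSeries p (PowerSeries.C ((u⁻¹ : ℤ_[p]ˣ) : ℤ_[p])) =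
      PowerSeries.C ((((u⁻¹ : ℤ_[p]ˣ) : ℤ_[p]) : ℚ_[p])) := by
    rw [PowerSeries.map_C, PadicInt.algebraMap_apply]
  have hu0 : (((u : ℤ_[p]) : ℚ_[p])) ≠ 0 := by
    intro h0
    have h1 : (((u⁻¹ : ℤ_[p]ˣ) : ℤ_[p]) : ℚ_[p]) * (((u : ℤ_[p]) : ℚ_[p])) = 1 := by
      rw [← PadicInt.coe_mul, Units.inv_mul, PadicInt.coe_one]
    rw [h0, mul_zero] at h1
    exact zero_ne_one h1
  have hιG : iwasawaToPowerSeries p (PowerSeries.C ((u⁻¹ : ℤ_[p]ˣ) : ℤ_[p]) * g₁) =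
      PowerSeries.C (ϖ : ℚ_[p]) * padicLFunctionMinusBranch f (unitRoot V p : ℚ_[p]) (p / 2) := by
    rw [map_mul, hιg₁, hCu, ← mul_assoc, ← map_mul, coe_units_inv_eq_inv, ← mul_assoc,
      inv_mul_cancel₀ hu0, one_mul]
  -- the constant term of `ϖ L⁻` is a unit on a unit row
  obtain ⟨C, hC⟩ := hCW
  have hord : IsOrdinaryAt V p := (isOrdinaryAt_iff V p).mpr ⟨hV.1, hV.2⟩
  obtain ⟨hnorm, hL⟩ := CensusX41.norm_coeff_zero_odd p hmod hp3 V W C hC hord hadd hf ϖ hϖ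
  set c : ℕ := (W.baseChange ℝ).numRealComponents with hc
  have hc12 : c = 1 ∨ c = 2 := by
    rw [hc, numRealComponents]
    split_ifs
    · exact Or.inr rfl
    · exact Or.inl rfl
  have hc0 : (c : ℚ) ≠ 0 := by rcases hc12 with h | h <;> rw [h] <;> norm_num
  have hcv : padicValRat p (c : ℚ) = 0 := by
    rcases hc12 with h | h
    · rw [h, Nat.cast_one]; exact padicValRat.one
    · have h2 : padicValRat p ((2 : ℕ) : ℚ) = 0 := by
        rw [padicValRat.of_nat, Nat.cast_eq_zero]
        exact padicValNat_primes hp2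
      rw [h]
      exact_mod_cast h2
  have hΩ : (W.realPeriodRat : ℂ) ≠ 0 := by exact_mod_cast W.realPeriodRat_pos_holds.ne'
  have hqS : ϖ * legendreMinusSymbolSum f p = c * q := by
    have h : ((ϖ * legendreMinusSymbolSum f p / (c : ℚ) : ℚ) : ℂ) = (q : ℂ) :=
      mul_right_cancel₀ hΩ (hL.symm.trans hq)
    have h' : ϖ * legendreMinusSymbolSum f p / (c : ℚ) = q := by exact_mod_cast h
    rw [div_eq_iff hc0] at h'
    rw [h', mul_comm]
  have h1 : ‖PowerSeries.constantCoeff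
      (PowerSeries.C (ϖ : ℚ_[p]) * padicLFunctionMinusBranch f (unitRoot V p : ℚ_[p]) (p / 2))‖ = 1 := by
    rw [← PowerSeries.coeff_zero_eq_constantCoeff_apply, hnorm, hqS]
    exact norm_ratCast_padic_eq_one_of_padicValRat_eq_zero p (mul_ne_zero hc0 hq0)
      (by rw [padicValRat.mul hc0 hq0, hcv, hv, add_zero])
  -- the node with `G = u⁻¹ g₁`, `m = n = 0`
  refine ⟨PowerSeries.C ((u⁻¹ : ℤ_[p]ˣ) : ℤ_[p]) * g₁, 0, 0, ?_, ?_⟩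
  · rw [span_singleton_eq_top_of_map_eq_of_norm_constantCoeff_eq_one p hιG h1]
    exact Submodule.mem_top
  · rw [pow_zero, map_one, one_mul, hιG]

/-- **UNIT rows, REDUCIBLE `W[p]`, (G-ord) odd branch: the rational `ω^{(p−1)/2}`-branch main
conjecture `ChiBranchRatCharEqOddAt W p` is a THEOREM from Wuthrich's half** (node above + the split
`chiBranchRatCharEqOddAt_of_wuthrichHalf_of_ratLowerDvd`): `char_Λ X(E/ℚ_∞) = Λ = (p^k·ϖ L_p⁻)`.
No image hypothesis, no certificate. [cite: Wuthrich2014, Thm. 16 (p. 397)]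
[cite: SkinnerUrban2014, Thm. 3.6.4, proof (p. 43)] -/
theorem chiBranchRatCharEqOddAt_of_wuthrichHalf_of_unitLValue
    (hWu : Wuthrich2014.thm16_halfEigenCharIdeal_dvd_cyclotomicPrime)
    (hmod : hasEntireLFunction_rat) (hj : 0 ≤ padicValRat p W.j) (hredW : Red W p) (hadd : Addv W p)
    {q : ℚ} (hq : W.entireLFunction 1 = (q : ℂ) * (W.realPeriodRat : ℂ)) (hq0 : q ≠ 0)
    (hv : padicValRat p q = 0) :
    ChiBranchRatCharEqOddAt W p :=
  chiBranchRatCharEqOddAt_of_wuthrichHalf_of_ratLowerDvd hWu hj hredW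
    (chiBranchRatLowerDvdOddAt_of_wuthrichHalf_of_unitLValue hWu hmod hj hredW hadd hq hq0 hv)

/-- **X3♯(G-ord) (`Red W p`, type (G)-ordinary), `p ≡ 3 (mod 4)`, UNIT rows: the one-sided node
`ChiBranchRatLowerDvdOddAt W p` is a THEOREM** (Wuthrich's half; no image hypothesis, no certificate).
[cite: Wuthrich2014, Thm. 16 (p. 397)] [cite: MazurTateTeitelbaum1986Invent, §I.13–I.14] -/
theorem ClassX3Gord.chiBranchRatLowerDvdOddAt_of_unitLValue
    (hWu : Wuthrich2014.thm16_halfEigenCharIdeal_dvd_cyclotomicPrime)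
    (hmod : hasEntireLFunction_rat) (hX : ClassX3Gord W p)
    {q : ℚ} (hq : W.entireLFunction 1 = (q : ℂ) * (W.realPeriodRat : ℂ)) (hq0 : q ≠ 0)
    (hv : padicValRat p q = 0) :
    ChiBranchRatLowerDvdOddAt W p :=
  chiBranchRatLowerDvdOddAt_of_wuthrichHalf_of_unitLValue hWu hmod
    (padicValRat_j_nonneg_of_typeGOrd W p hX.typeGOrd) hX.classX3.1 hX.addv hq hq0 hv

/-- **X3♯(G-ord), `p ≡ 3 (mod 4)`, UNIT rows: the rational odd-branch main conjecture
`ChiBranchRatCharEqOddAt W p` is a THEOREM** (no image hypothesis, no certificate).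
[cite: Wuthrich2014, Thm. 16 (p. 397)] [cite: SkinnerUrban2014, Thm. 3.6.4, proof (p. 43)] -/
theorem ClassX3Gord.chiBranchRatCharEqOddAt_of_unitLValue
    (hWu : Wuthrich2014.thm16_halfEigenCharIdeal_dvd_cyclotomicPrime)
    (hmod : hasEntireLFunction_rat) (hX : ClassX3Gord W p)
    {q : ℚ} (hq : W.entireLFunction 1 = (q : ℂ) * (W.realPeriodRat : ℂ)) (hq0 : q ≠ 0)
    (hv : padicValRat p q = 0) :
    ChiBranchRatCharEqOddAt W p :=
  hX.chiBranchRatCharEqOddAt_of_ratLowerDvdOdd hWu (hX.chiBranchRatLowerDvdOddAt_of_unitLValue hWu hmod hq hq0 hv)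

end GordOdd

/-! ### §2 Reducible rows, even branch (`p ≡ 1 (mod 4)`): the node and the rational MC on the unit rows -/

section GordEven

variable {W : WeierstrassCurve ℚ} [W.IsElliptic] [W.IsGloballyMinimal] {p : ℕ} [hp : Fact p.Prime]

/-- **UNIT rows, REDUCIBLE `W[p]`, (G-ord) even branch (`p ≡ 1 (mod 4)`): Wuthrich's half ALONE gives
the one-sided node `ChiBranchRatLowerDvdAt W p`.** Wuthrich's `g₁ ∈ char_Λ X(E/ℚ_∞)` with
`ι g₁ = u·ϖ·L_p(f♭, α♭, ω^{(p−1)/2}, T)` has unit constant term on a unit row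
(`‖(ϖ L_p)(0)‖ = ‖ϖ·∑(a/p)[a/p]⁺_f‖ = ‖q‖ = 1`, `CensusX41.norm_coeff_zero_even`), so `(u⁻¹ g₁) = Λ`.
No image hypothesis. [cite: Wuthrich2014, Thm. 16 (p. 397)]
[cite: MazurTateTeitelbaum1986Invent, §I.10 (10.1), §I.13] [cite: Pal2012, Thm. 3.2] -/
theorem chiBranchRatLowerDvdAt_of_wuthrichHalf_of_unitLValue
    (hWu : Wuthrich2014.thm16_halfEigenCharIdeal_dvd_cyclotomicPrime)
    (hmod : hasEntireLFunction_rat) (hj : 0 ≤ padicValRat p W.j) (hredW : Red W p) (hadd : Addv W p)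
    {q : ℚ} (hq : W.entireLFunction 1 = (q : ℂ) * (W.realPeriodRat : ℂ)) (hq0 : q ≠ 0)
    (hv : padicValRat p q = 0) :
    ChiBranchRatLowerDvdAt W p := by
  intro V _ _ κ γ N _ f hp1 hCW hV hκ hγ hcv hf D ϖ hϖ g _hg
  -- Wuthrich's element
  obtain ⟨-, g₁, -, u, hιg₁⟩ :=
    exists_mem_charIdeal_map_eq_unit_mul_branch_of_wuthrichHalf W p hWu hj hredW V hp1 hCW (Or.inl hV)
      hκ hγ hcv hf D ϖ hϖ
  have hCu : iwasawaToPowerSeries p (PowerSeries.C ((u⁻¹ : ℤ_[p]ˣ) : ℤ_[p])) =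
      PowerSeries.C ((((u⁻¹ : ℤ_[p]ˣ) : ℤ_[p]) : ℚ_[p])) := by
    rw [PowerSeries.map_C, PadicInt.algebraMap_apply]
  have hu0 : (((u : ℤ_[p]) : ℚ_[p])) ≠ 0 := by
    intro h0
    have h1 : (((u⁻¹ : ℤ_[p]ˣ) : ℤ_[p]) : ℚ_[p]) * (((u : ℤ_[p]) : ℚ_[p])) = 1 := by
      rw [← PadicInt.coe_mul, Units.inv_mul, PadicInt.coe_one]
    rw [h0, mul_zero] at h1
    exact zero_ne_one h1
  have hιG : iwasawaToPowerSeries p (PowerSeries.C ((u⁻¹ : ℤ_[p]ˣ) : ℤ_[p]) * g₁) =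
      PowerSeries.C (ϖ : ℚ_[p]) * padicLFunctionBranch f (unitRoot V p : ℚ_[p]) (p / 2) := by
    rw [map_mul, hιg₁, hCu, ← mul_assoc, ← map_mul, coe_units_inv_eq_inv, ← mul_assoc,
      inv_mul_cancel₀ hu0, one_mul]
  -- the constant term of `ϖ L_p` is `ϖ S⁺ = q`, a unit
  obtain ⟨C, hC⟩ := hCW
  have hord : IsOrdinaryAt V p := (isOrdinaryAt_iff V p).mpr ⟨hV.1, hV.2⟩
  obtain ⟨hnorm, hL⟩ := CensusX41.norm_coeff_zero_even p hmod hp1 V W C hC hord hadd hf ϖ hϖ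
  have hΩ : (W.realPeriodRat : ℂ) ≠ 0 := by exact_mod_cast W.realPeriodRat_pos_holds.ne'
  have hqS : ϖ * legendrePlusSymbolSum f p = q := by
    have h : ((ϖ * legendrePlusSymbolSum f p : ℚ) : ℂ) = (q : ℂ) :=
      mul_right_cancel₀ hΩ (hL.symm.trans hq)
    exact_mod_cast h
  have h1 : ‖PowerSeries.constantCoeff
      (PowerSeries.C (ϖ : ℚ_[p]) * padicLFunctionBranch f (unitRoot V p : ℚ_[p]) (p / 2))‖ = 1 := by
    rw [← PowerSeries.coeff_zero_eq_constantCoeff_apply, hnorm, hqS]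
    exact norm_ratCast_padic_eq_one_of_padicValRat_eq_zero p hq0 hv
  refine ⟨PowerSeries.C ((u⁻¹ : ℤ_[p]ˣ) : ℤ_[p]) * g₁, 0, 0, ?_, ?_⟩
  · rw [span_singleton_eq_top_of_map_eq_of_norm_constantCoeff_eq_one p hιG h1]
    exact Submodule.mem_top
  · rw [pow_zero, map_one, one_mul, hιG]

/-- **UNIT rows, REDUCIBLE `W[p]`, (G-ord) even branch: the rational `ω^{(p−1)/2}`-branch main
conjecture `ChiBranchRatCharEqAt W p` is a THEOREM from Wuthrich's half** (node + split
`chiBranchRatCharEqAt_of_wuthrichHalf_of_ratLowerDvd`). No image hypothesis, no certificate.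
[cite: Wuthrich2014, Thm. 16 (p. 397)] [cite: SkinnerUrban2014, Thm. 3.6.4, proof (p. 43)] -/
theorem chiBranchRatCharEqAt_of_wuthrichHalf_of_unitLValue
    (hWu : Wuthrich2014.thm16_halfEigenCharIdeal_dvd_cyclotomicPrime)
    (hmod : hasEntireLFunction_rat) (hj : 0 ≤ padicValRat p W.j) (hredW : Red W p) (hadd : Addv W p)
    {q : ℚ} (hq : W.entireLFunction 1 = (q : ℂ) * (W.realPeriodRat : ℂ)) (hq0 : q ≠ 0)
    (hv : padicValRat p q = 0) :
    ChiBranchRatCharEqAt W p :=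
  chiBranchRatCharEqAt_of_wuthrichHalf_of_ratLowerDvd hWu hj hredW
    (chiBranchRatLowerDvdAt_of_wuthrichHalf_of_unitLValue hWu hmod hj hredW hadd hq hq0 hv)

/-- **X3♯(G-ord), `p ≡ 1 (mod 4)`, UNIT rows: the one-sided node `ChiBranchRatLowerDvdAt W p` is a
THEOREM** (Wuthrich's half; no image hypothesis, no certificate).
[cite: Wuthrich2014, Thm. 16 (p. 397)] [cite: MazurTateTeitelbaum1986Invent, §I.13–I.14] -/
theorem ClassX3Gord.chiBranchRatLowerDvdAt_of_unitLValue
    (hWu : Wuthrich2014.thm16_halfEigenCharIdeal_dvd_cyclotomicPrime)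
    (hmod : hasEntireLFunction_rat) (hX : ClassX3Gord W p)
    {q : ℚ} (hq : W.entireLFunction 1 = (q : ℂ) * (W.realPeriodRat : ℂ)) (hq0 : q ≠ 0)
    (hv : padicValRat p q = 0) :
    ChiBranchRatLowerDvdAt W p :=
  chiBranchRatLowerDvdAt_of_wuthrichHalf_of_unitLValue hWu hmod
    (padicValRat_j_nonneg_of_typeGOrd W p hX.typeGOrd) hX.classX3.1 hX.addv hq hq0 hv

/-- **X3♯(G-ord), `p ≡ 1 (mod 4)`, UNIT rows: the rational even-branch main conjecture
`ChiBranchRatCharEqAt W p` is a THEOREM** (no image hypothesis, no certificate).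
[cite: Wuthrich2014, Thm. 16 (p. 397)] [cite: SkinnerUrban2014, Thm. 3.6.4, proof (p. 43)] -/
theorem ClassX3Gord.chiBranchRatCharEqAt_of_unitLValue
    (hWu : Wuthrich2014.thm16_halfEigenCharIdeal_dvd_cyclotomicPrime)
    (hmod : hasEntireLFunction_rat) (hX : ClassX3Gord W p)
    {q : ℚ} (hq : W.entireLFunction 1 = (q : ℂ) * (W.realPeriodRat : ℂ)) (hq0 : q ≠ 0)
    (hv : padicValRat p q = 0) :
    ChiBranchRatCharEqAt W p :=
  hX.chiBranchRatCharEqAt_of_ratLowerDvd hWu (hX.chiBranchRatLowerDvdAt_of_unitLValue hWu hmod hq hq0 hv)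

end GordEven

/-! ### §3 X3♯(G-ord) ends on the unit rows: `BSD(E,p)` with every hypothesis printed or a row datum -/

section Ends

variable {W : WeierstrassCurve ℚ} [W.IsElliptic] [W.IsGloballyMinimal]

/-- **X3♯(G-ord) at `3`, `r_an = 0`, non-CM, non-anomalous, UNIT rows (`L(E,1) = q·Ω_E`, `ord₃ q = 0`):
the LOWER half `ord₃ #Ш_an ≤ ord₃ #Ш` with NO typed input** — the node from Wuthrich's half (§1), the
unit coefficient free on the unit rows (`CensusX41.unitCoeffCert_odd`, `n = 0`), then p253502's
`ClassX3Gord.missingLowerBoundAt_three_rankZero_of_ratLowerDvdOdd_of_unitCoeff` (Delbourgo 2002 at `3`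
`hDel3`, GZK, modularity). No image hypothesis. Nothing booked. [cite: Wuthrich2014, Thm. 16 (p. 397)]
[cite: Delbourgo2002, Theorem (A), (B) (p. 40)] [cite: MazurTateTeitelbaum1986Invent, §I.13–I.14]
[cite: Miller2011LMS, Def. 1.1] -/
theorem ClassX3Gord.missingLowerBoundAt_three_rankZero_of_wuthrichHalf_of_unitLValue [Fact (Nat.Prime 3)]
    (hWu : Wuthrich2014.thm16_halfEigenCharIdeal_dvd_cyclotomicPrime)
    (hDel3 : Delbourgo2002.mainTheorem_three)
    (hGZK : rank_eq_analyticRank_of_analyticRank_le_one) (hmod : hasEntireLFunction_rat)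
    (hmodD : nonempty_modularParametrizationData)
    (hX : ClassX3Gord W 3) (hcm : ¬ W.HasCM) (hr : W.analyticRank = 0)
    (hna : Delbourgo2002.ReductionNonAnomalous W 3)
    {q : ℚ} (hq : W.entireLFunction 1 = (q : ℂ) * (W.realPeriodRat : ℂ)) (hq0 : q ≠ 0)
    (hv : padicValRat 3 q = 0) :
    MissingLowerBoundAt W 3 :=
  hX.missingLowerBoundAt_three_rankZero_of_ratLowerDvdOdd_of_unitCoeff hWu hDel3 hGZK hmod hmodD hcm hr hna
    (hX.chiBranchRatLowerDvdOddAt_of_unitLValue hWu hmod hq hq0 hv)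
    (by exact_mod_cast CensusX41.unitCoeffCert_odd 3 hmod (by norm_num) W hX.addv hq hq0 hv)

/-- **X3♯(G-ord) at `3`, `r_an = 0`, non-CM, non-anomalous, UNIT rows: `BSD(E,3)` with NO typed input
and NO image hypothesis** — every hypothesis is a PRINTED theorem carried as a binder (Wuthrich 2014
Thm. 16 `hWu`, serving the node (§1), the upgrade to the rational equality AND the upper half;
Delbourgo 2002 at `3` `hDel3`; Delbourgo 1998 Prop. 4 `hDel`; GZK; modularity) or a ROW DATUM
(`ClassX3Gord W 3`, non-CM, `r_an = 0`, `a_3(E♭) ≢ 1`, `L(E,1) = q·Ω_E` with `ord₃ q = 0`). Composition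
of §1 with p253502's `ClassX3Gord.bsdp_three_rankZero_of_ratLowerDvdOdd_of_unitLValue`. On these rows
`E[3]` is reducible, so `3`-torsion and the LOWER half are live. Nothing booked; X3♯(G-ord) stays
CONSTRUCTION-SHAPED off the unit rows. [cite: Wuthrich2014, Thm. 16 (p. 397)]
[cite: Delbourgo2002, Theorem (A), (B) (p. 40)] [cite: Delbourgo1998, Prop. 4 (p. 144)]
[cite: MazurTateTeitelbaum1986Invent, §I.13–I.14] [cite: Miller2011LMS, §1 and Def. 1.1] -/
theorem ClassX3Gord.bsdp_three_rankZero_of_wuthrichHalf_of_unitLValue [Fact (Nat.Prime 3)]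
    (hWu : Wuthrich2014.thm16_halfEigenCharIdeal_dvd_cyclotomicPrime)
    (hDel3 : Delbourgo2002.mainTheorem_three)
    (hDel : Delbourgo1998.prop4_rankZero_pow_dvd_constantCoeff)
    (hGZK : rank_eq_analyticRank_of_analyticRank_le_one) (hmod : hasEntireLFunction_rat)
    (hmodD : nonempty_modularParametrizationData)
    (hX : ClassX3Gord W 3) (hcm : ¬ W.HasCM) (hr : W.analyticRank = 0)
    (hna : Delbourgo2002.ReductionNonAnomalous W 3)
    {q : ℚ} (hq : W.entireLFunction 1 = (q : ℂ) * (W.realPeriodRat : ℂ)) (hq0 : q ≠ 0)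
    (hv : padicValRat 3 q = 0) :
    BSDp W 3 :=
  hX.bsdp_three_rankZero_of_ratLowerDvdOdd_of_unitLValue hWu hDel3 hDel hGZK hmod hmodD hcm hr hna
    (hX.chiBranchRatLowerDvdOddAt_of_unitLValue hWu hmod hq hq0 hv) hq hq0 hv

variable {p : ℕ} [hp : Fact p.Prime]

/-- **X3♯(G-ord) ∩ `I₀*` (`e = 2`) ∩ non-anomalous, `p ≥ 5`, `p ≡ 3 (mod 4)`, non-CM, `r_an = 0`, UNIT
rows: `BSD(E,p)` with NO typed input and NO image hypothesis** (§1 node + free unit coefficient +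
p251406's `ClassX3Gord.bsdp_rankZero_of_ratCharEqOdd_of_unitCoeff_of_wuthrichHalf`: Delbourgo 2002
`hDel`, Delbourgo 1998 `hDel98`, GZK, modularity, Wuthrich's upper half). Nothing booked.
[cite: Wuthrich2014, Thm. 16 (p. 397)] [cite: Delbourgo2002, Theorem (A), (B) (p. 40)]
[cite: Delbourgo1998, Prop. 4 (p. 144)] [cite: Miller2011LMS, Def. 1.1] -/
theorem ClassX3Gord.bsdp_rankZero_of_wuthrichHalf_of_unitLValue_odd
    (hWu : Wuthrich2014.thm16_halfEigenCharIdeal_dvd_cyclotomicPrime)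
    (hDel : Delbourgo2002.mainTheorem)
    (hDel98 : Delbourgo1998.prop4_rankZero_pow_dvd_constantCoeff)
    (hGZK : rank_eq_analyticRank_of_analyticRank_le_one) (hmod : hasEntireLFunction_rat)
    (hmodD : nonempty_modularParametrizationData)
    (hX : ClassX3Gord W p) (he : semistabilityIndex W p = 2) (hp5 : 5 ≤ p) (hp4 : p % 4 = 3)
    (hcm : ¬ W.HasCM) (hr : W.analyticRank = 0) (hna : Delbourgo2002.ReductionNonAnomalous W p)
    {q : ℚ} (hq : W.entireLFunction 1 = (q : ℂ) * (W.realPeriodRat : ℂ)) (hq0 : q ≠ 0)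
    (hv : padicValRat p q = 0) :
    BSDp W p :=
  ClassX3Gord.bsdp_rankZero_of_ratCharEqOdd_of_unitCoeff_of_wuthrichHalf hDel hWu hDel98 hGZK hmod hmodD hX
    he hp5 hp4 hcm hr hna (hX.chiBranchRatCharEqOddAt_of_unitLValue hWu hmod hq hq0 hv)
    (CensusX41.unitCoeffCert_odd p hmod hp4 W hX.addv hq hq0 hv)

/-- **X3♯(G-ord) ∩ `I₀*` (`e = 2`) ∩ non-anomalous, `p ≥ 5`, `p ≡ 1 (mod 4)`, non-CM, `r_an = 0`, UNIT
rows: `BSD(E,p)` with NO typed input and NO image hypothesis** (§2 node + free unit coefficient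
(`CensusX41.unitCoeffCert_even`) + p251406's
`ClassX3Gord.bsdp_rankZero_of_ratCharEq_of_unitCoeff_of_wuthrichHalf`: Delbourgo 2002 `hDel`,
Delbourgo 1998 `hDel98`, Pal `hPal`, GZK, modularity, Wuthrich's upper half). Nothing booked.
[cite: Wuthrich2014, Thm. 16 (p. 397)] [cite: Delbourgo2002, Theorem (A), (B) (p. 40)]
[cite: Delbourgo1998, Prop. 4 (p. 144)] [cite: Pal2012, Thm. 3.2] [cite: Miller2011LMS, Def. 1.1] -/
theorem ClassX3Gord.bsdp_rankZero_of_wuthrichHalf_of_unitLValue_even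
    (hWu : Wuthrich2014.thm16_halfEigenCharIdeal_dvd_cyclotomicPrime)
    (hDel : Delbourgo2002.mainTheorem)
    (hDel98 : Delbourgo1998.prop4_rankZero_pow_dvd_constantCoeff)
    (hPal : Pal2012.thm32_sqrt_mul_realPeriodRat_twist_eq_of_prime_one_mod_four)
    (hGZK : rank_eq_analyticRank_of_analyticRank_le_one) (hmod : hasEntireLFunction_rat)
    (hmodD : nonempty_modularParametrizationData)
    (hX : ClassX3Gord W p) (he : semistabilityIndex W p = 2) (hp5 : 5 ≤ p) (hp4 : p % 4 = 1)
    (hcm : ¬ W.HasCM) (hr : W.analyticRank = 0) (hna : Delbourgo2002.ReductionNonAnomalous W p)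
    {q : ℚ} (hq : W.entireLFunction 1 = (q : ℂ) * (W.realPeriodRat : ℂ)) (hq0 : q ≠ 0)
    (hv : padicValRat p q = 0) :
    BSDp W p :=
  ClassX3Gord.bsdp_rankZero_of_ratCharEq_of_unitCoeff_of_wuthrichHalf hDel hWu hDel98 hPal hGZK hmod hmodD
    hX he hp5 hp4 hcm hr hna (hX.chiBranchRatCharEqAt_of_unitLValue hWu hmod hq hq0 hv)
    (CensusX41.unitCoeffCert_even p hmod hp4 W hX.addv hq hq0 hv)

end Ends

end Summit.BirchSwinnertonDyer.Rank1Residual.Additive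

end
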